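import Literature.Geometry.DiscreteGeometry.KissingSearchStructure
import HarnessLib

/-!
# Soundness of the narrowing rules of the kissing growth search (trims and pairing)

Topic `Literature/Geometry/DiscreteGeometry`; provefact brick for `Hales2012_contactGraphTame` /
`Hales2012_contactGraphFccOrHcp`, part 4.  Everything here is PROVED; nothing is named.
For a structure `M : KConf` and a state `s` with `Realizes M s`:

* Part A — `Realizes.sdom`: relabelling a labelled side by a code that still means the truth
  keeps the state realized; `encl_of_doms` (the bracket over any three valid domains holding the
  true symbols encloses the angle).
* Part B — `firstOk` / `lastOk` find an admissible cell when one exists; **`trimSide_sound`**: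
  trimming a side of a placed slot against a window containing its true angle never kills and
  keeps the state realized; `trimTrisAt_sound`.
* Part C — `ZCELL = 11`, `gridPt j < 0` for `j < 11`; `apexes` lists the third vertices;
  **`pairRuleAt_sound`**, `pairRulesAt_sound`.

## References
* T. C. Hales, arXiv:1209.6043 (2012), proof of Theorem 2 (pairing) and of Lemma 9.
  [`Hales2012`]
* R. E. Moore, *Interval Analysis* (1966), Theorem 3.1, §4.4. [`Moore1966`]
-/

namespace Literature.Geometry.DiscreteGeometry

namespace KissingSearch

open Real Literature.Analysis.ValidatedNumerics KissingLP NonemptyInterval Finset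

/-! ### Part A. Writing a truthful code keeps a state realized -/

/-- Valid codes with the same vertex set are equal. [folklore] -/
theorem eq_of_tset_eq {s t : ℕ} (hs : TriValid s) (ht : TriValid t) (hst : tset s = tset t) : s = t := by
  obtain ⟨s1, s2, s3, s4⟩ := hs
  obtain ⟨t1, t2, t3, t4⟩ := ht
  unfold tset at hst
  have m0 : tv0 s ∈ ({tv0 t, tv1 t, tv2 t} : Finset ℕ) := by rw [← hst]; simp
  have m1 : tv1 s ∈ ({tv0 t, tv1 t, tv2 t} : Finset ℕ) := by rw [← hst]; simp
  have m2 : tv2 s ∈ ({tv0 t, tv1 t, tv2 t} : Finset ℕ) := by rw [← hst]; simp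
  have n0 : tv0 t ∈ ({tv0 s, tv1 s, tv2 s} : Finset ℕ) := by rw [hst]; simp
  have n1 : tv1 t ∈ ({tv0 s, tv1 s, tv2 s} : Finset ℕ) := by rw [hst]; simp
  have n2 : tv2 t ∈ ({tv0 s, tv1 s, tv2 s} : Finset ℕ) := by rw [hst]; simp
  simp only [Finset.mem_insert, Finset.mem_singleton] at m0 m1 m2 n0 n1 n2
  have e0 : tv0 s = tv0 t := by omega
  have e1 : tv1 s = tv1 t := by omega
  have e2 : tv2 s = tv2 t := by omega
  rw [s4, t4, e0, e1, e2]

/-- Unordered pairs of distinct labels as `Finset` equalities. [folklore] -/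
theorem pair_cases {a b p q : ℕ} (h : (p = a ∧ q = b) ∨ (p = b ∧ q = a)) :
    ({p, q} : Finset ℕ) = {a, b} := by
  rcases h with ⟨rfl, rfl⟩ | ⟨rfl, rfl⟩
  · rfl
  · exact Finset.pair_comm _ _

/-- **Writing a truthful code on a labelled side keeps the state realized.** [folklore] -/
theorem Realizes.sdom {M : KConf} {s : St} (hR : Realizes M s) {a b r : ℕ} (ha : a < 12)
    (hb : b < 12) (hab : a ≠ b) (hlab : s.gdom a b ≠ UNL) (hr : r ≠ UNL)
    (hsem : DomSem r (M.g a b)) : Realizes M (s.sdom a b r) where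
  size_dom := by rw [size_dom_sdom]; exact hR.size_dom
  size_sc := hR.size_sc
  valid := hR.valid
  mem := hR.mem
  nodup := hR.nodup
  sc_eq := fun p q hp hq hpq => by rw [gsc_sdom]; exact hR.sc_eq p q hp hq hpq
  dom := fun p q hp hq hpq => by
    by_cases hidx : sIdx p q = sIdx a b
    · have e : (s.sdom a b r).gdom p q = r := by
        unfold St.gdom; rw [hidx]; exact gdom_sdom_self (by rw [hR.size_dom]; exact sIdx_lt ha hb)
      rw [e]
      rcases (sIdx_eq_iff hp hq ha hb).1 hidx with ⟨rfl, rfl⟩ | ⟨rfl, rfl⟩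
      · exact hsem
      · rw [M.g_symm]; exact hsem
    · rw [gdom_sdom_of_ne hidx]; exact hR.dom p q hp hq hpq
  lab_side := fun p q hp hq hpq hl => by
    rw [tris_sdom]
    by_cases hidx : sIdx p q = sIdx a b
    · obtain ⟨t, ht, hat, hbt⟩ := hR.lab_side a b ha hb hab hlab
      rcases (sIdx_eq_iff hp hq ha hb).1 hidx with ⟨rfl, rfl⟩ | ⟨rfl, rfl⟩
      · exact ⟨t, ht, hat, hbt⟩
      · exact ⟨t, ht, hbt, hat⟩
    · rw [gdom_sdom_of_ne hidx] at hl
      exact hR.lab_side p q hp hq hpq hl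
  side_lab := fun t ht p hp q hq hpq => by
    by_cases hidx : sIdx p q = sIdx a b
    · unfold St.gdom; rw [hidx]
      rw [show (s.sdom a b r).dom.getD (sIdx a b) UNL = (s.sdom a b r).gdom a b from rfl,
        gdom_sdom_self (by rw [hR.size_dom]; exact sIdx_lt ha hb)]
      exact hr
    · rw [gdom_sdom_of_ne hidx]
      rw [tris_sdom] at ht
      exact hR.side_lab t ht p hp q hq hpq

/-- **The bracket over three valid domains holding the true symbols encloses the angle** of a
triangle of `M`. [cite: Moore1966, Theorem 3.1] -/
theorem encl_of_doms {M : KConf} {ra rb rc σa σb σc v a b : ℕ} {t : Finset ℕ} (hT : t ∈ M.T)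
    (hv : v ∈ t) (ha : a ∈ t) (hb : b ∈ t) (hva : v ≠ a) (hvb : v ≠ b) (hab : a ≠ b)
    (vda : ValidDom ra) (vdb : ValidDom rb) (vdc : ValidDom rc)
    (hσa : σa ∈ symsList ra) (hσb : σb ∈ symsList rb) (hσc : σc ∈ symsList rc)
    (hxa : SymMem σa (M.g v a)) (hxb : SymMem σb (M.g v b)) (hxc : SymMem σc (M.g a b)) :
    Encl (rangeBr ra rb rc) (M.ang t v) := by
  have hcos := M.cos_law _ hT v hv a ha b hb hva hvb hab
  have hP := M.circum _ hT v hv a ha b hb hva hvb hab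
  have hx1 := sq_lt_one_of_symMem (le_K_of_mem_symsList vda hσa) hxa
  have hy1 := sq_lt_one_of_symMem (le_K_of_mem_symsList vdb hσb) hxb
  have hbasic := basic_sound hxa hxb hxc hx1 hy1 hP (M.ang_nonneg _ _) (M.ang_le_pi _ _) hcos
  rw [← btab_eq (lt_NS_of_mem_symsList vda hσa) (lt_NS_of_mem_symsList vdb hσb)
    (lt_NS_of_mem_symsList vdc hσc)] at hbasic
  exact rangeBr_sound vda vdb vdc hσa hσb (rangeC_sound hσc hbasic)

/-- The singleton range of a cell. [folklore] -/
theorem symsList_mkR_self {c : ℕ} (h1 : 1 ≤ c) (hK : c ≤ K) : symsList (mkR c c) = [c] := by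
  have hK' : K = 15 := rfl
  unfold symsList
  have hne : mkR c c ≠ 0 := by unfold mkR; omega
  rw [if_neg hne]
  have elo : rLo (mkR c c) = c := by unfold rLo mkR; omega
  have ehi : rHi (mkR c c) = c := by unfold rHi mkR; omega
  rw [elo, ehi, show c + 1 - c = 1 by omega]
  rfl

/-! ### Part B. Trimming a side -/

/-- `firstOk` finds an admissible index at most any admissible one. [folklore] -/
theorem firstOk_spec (ok : ℕ → Bool) : ∀ (n lo c : ℕ), lo ≤ c → c < lo + n → ok c = true →
    ∃ lo', firstOk ok lo n = some lo' ∧ lo ≤ lo' ∧ lo' ≤ c ∧ ok lo' = true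
  | 0, lo, c, h1, h2, _ => by omega
  | n + 1, lo, c, h1, h2, hc => by
    unfold firstOk
    by_cases h : ok lo = true
    · exact ⟨lo, by rw [if_pos h], le_rfl, h1, h⟩
    · rw [if_neg h]
      have hne : lo ≠ c := fun e => h (e ▸ hc)
      obtain ⟨lo', e, h3, h4, h5⟩ := firstOk_spec ok n (lo + 1) c (by omega) (by omega) hc
      exact ⟨lo', e, by omega, h4, h5⟩

/-- `lastOk` finds an admissible index at least any admissible one. [folklore] -/
theorem lastOk_spec (ok : ℕ → Bool) : ∀ (n hi c : ℕ), c ≤ hi → hi < c + n → ok c = true →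
    ∃ hi', lastOk ok hi n = some hi' ∧ c ≤ hi' ∧ hi' ≤ hi ∧ ok hi' = true
  | 0, hi, c, h1, h2, _ => by omega
  | n + 1, hi, c, h1, h2, hc => by
    unfold lastOk
    by_cases h : ok hi = true
    · exact ⟨hi, by rw [if_pos h], h1, le_rfl, h⟩
    · rw [if_neg h]
      have hne : hi ≠ c := fun e => h (e ▸ hc)
      obtain ⟨hi', e, h3, h4, h5⟩ := lastOk_spec ok n (hi - 1) c (by omega) (by omega) hc
      exact ⟨hi', e, h3, by omega, h5⟩

/-- A `Nat` comparison from a real comparison of multiples of `δ`. [folklore] -/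
theorem nat_le_of_mul_delta_le {m n : ℕ} (h : (m : ℝ) * (δ : ℝ) ≤ (n : ℝ) * (δ : ℝ)) : m ≤ n := by
  have := le_of_mul_le_mul_right h delta_pos
  exact_mod_cast this

/-- **Soundness of `trimSide`.**  If the window `[wlo δ, whi δ]` contains the true angle of the
placed slot `(t, v)`, trimming one of its sides never kills and keeps the state realized.
[cite: Moore1966, §4.4] -/
theorem trimSide_sound {M : KConf} {s : St} (hR : Realizes M s) {t : ℕ} (ht : t ∈ s.tris.toList)
    {v : ℕ} (hv : v ∈ tset t) (role wlo whi : ℕ)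
    (hw : (wlo : ℝ) * (δ : ℝ) ≤ M.ang (tset t) v ∧ M.ang (tset t) v ≤ (whi : ℝ) * (δ : ℝ)) :
    s.trimSide t v role wlo whi ≠ none ∧
      ∀ s', s.trimSide t v role wlo whi = some s' → Realizes M s' ∧ s'.tris = s.tris ∧ s'.sc = s.sc := by
  have hval := hR.valid t ht
  obtain ⟨hva, hvb, hab, hset⟩ := others_spec hval hv
  set a := (others t v).1 with ha_def
  set b := (others t v).2 with hb_def
  have hT : tset t ∈ M.T := hR.mem t ht
  have hv12 : v < 12 := lt_of_mem_tset hval hv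
  have haT : a ∈ tset t := by rw [hset]; simp
  have hbT : b ∈ tset t := by rw [hset]; simp
  have ha12 : a < 12 := lt_of_mem_tset hval haT
  have hb12 : b < 12 := lt_of_mem_tset hval hbT
  have lva := hR.side_lab t ht v hv a haT hva
  have lvb := hR.side_lab t ht v hv b hbT hvb
  have lab := hR.side_lab t ht a haT b hbT hab
  have dva := hR.dom v a hv12 ha12 hva
  have dvb := hR.dom v b hv12 hb12 hvb
  have dab := hR.dom a b ha12 hb12 hab
  obtain ⟨vda, σa, hσa, hxa⟩ := exists_symMem_of_domSem dva lva
  obtain ⟨vdb, σb, hσb, hxb⟩ := exists_symMem_of_domSem dvb lvb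
  obtain ⟨vdc, σc, hσc, hxc⟩ := exists_symMem_of_domSem dab lab
  -- the code, side and true value selected by `role`
  set ra := s.gdom v a with hra
  set rb := s.gdom v b with hrb
  set rc := s.gdom a b with hrc
  set r := (if role = 0 then ra else if role = 1 then rb else rc) with hr_def
  -- the admissibility test
  set ok : ℕ → Bool := fun c =>
    let rr := mkR c c
    let br := if role = 0 then rangeBr rr rb rc else if role = 1 then rangeBr ra rr rc else rangeBr ra rb rr
    br != NOBR && brLo br ≤ whi && wlo ≤ brHi br with hok
  -- the true cell of the selected side passes the test
  have okc : ∀ {c : ℕ}, 1 ≤ c → c ≤ K →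
      (role = 0 → SymMem c (M.g v a)) → (role ≠ 0 → role = 1 → SymMem c (M.g v b)) →
      (role ≠ 0 → role ≠ 1 → SymMem c (M.g a b)) → ok c = true := by
    intro c h1 hK h0 h1' h2'
    have vdcc : ValidDom (mkR c c) := validDom_mkR h1 le_rfl hK
    have hcc : c ∈ symsList (mkR c c) := by rw [symsList_mkR_self h1 hK]; simp
    have hE : Encl (if role = 0 then rangeBr (mkR c c) rb rc else if role = 1 then rangeBr ra (mkR c c) rc
        else rangeBr ra rb (mkR c c)) (M.ang (tset t) v) := by
      by_cases r0 : role = 0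
      · rw [if_pos r0]
        exact encl_of_doms hT hv haT hbT hva hvb hab vdcc vdb vdc hcc hσb hσc (h0 r0) hxb hxc
      · by_cases r1 : role = 1
        · rw [if_neg r0, if_pos r1]
          exact encl_of_doms hT hv haT hbT hva hvb hab vda vdcc vdc hσa hcc hσc hxa (h1' r0 r1) hxc
        · rw [if_neg r0, if_neg r1]
          exact encl_of_doms hT hv haT hbT hva hvb hab vda vdb vdcc hσa hσb hcc hxa hxb (h2' r0 r1)
    obtain ⟨hne, hlo, hhi⟩ := hE
    have e1 : brLo (if role = 0 then rangeBr (mkR c c) rb rc else if role = 1 then rangeBr ra (mkR c c) rc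
        else rangeBr ra rb (mkR c c)) ≤ whi := nat_le_of_mul_delta_le (hlo.trans hw.2)
    have e2 : wlo ≤ brHi (if role = 0 then rangeBr (mkR c c) rb rc else if role = 1 then rangeBr ra (mkR c c) rc
        else rangeBr ra rb (mkR c c)) := nat_le_of_mul_delta_le (hw.1.trans hhi)
    simp only [hok, Bool.and_eq_true, bne_iff_ne, ne_eq, decide_eq_true_eq]
    exact ⟨⟨hne, e1⟩, e2⟩
  unfold St.trimSide
  simp only
  rw [← ha_def, ← hb_def]
  simp only [← hra, ← hrb, ← hrc]
  by_cases htriv : r = 0 ∨ r = UNL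
  · rw [← hr_def, if_pos htriv]; exact ⟨Option.some_ne_none _, fun s' h => by cases h; exact ⟨hR, rfl, rfl⟩⟩
  · rw [← hr_def, if_neg htriv]
    rw [not_or] at htriv
    -- the selected side: its code is a valid range, its value lies in a cell of the range
    have sel : ∃ x : ℝ, DomSem r x ∧ (role = 0 → x = M.g v a) ∧ (role ≠ 0 → role = 1 → x = M.g v b) ∧
        (role ≠ 0 → role ≠ 1 → x = M.g a b) := by
      by_cases r0 : role = 0
      · exact ⟨M.g v a, by rw [hr_def, if_pos r0]; exact dva, fun _ => rfl, fun h => absurd r0 h, fun h => absurd r0 h⟩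
      · by_cases r1 : role = 1
        · exact ⟨M.g v b, by rw [hr_def, if_neg r0, if_pos r1]; exact dvb, fun h => absurd h r0, fun _ _ => rfl,
            fun _ h => absurd r1 h⟩
        · exact ⟨M.g a b, by rw [hr_def, if_neg r0, if_neg r1]; exact dab, fun h => absurd h r0,
            fun _ h => absurd h r1, fun _ _ => rfl⟩
    obtain ⟨x, hxsem, hx0, hx1, hx2⟩ := sel
    rcases hxsem with h | ⟨h, -⟩ | ⟨vd, -, hxne, hxlo, hxhi⟩
    · exact absurd h htriv.2
    · exact absurd h htriv.1
    rcases vd with h | ⟨hl1, hl2, hl3, hl4⟩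
    · exact absurd h htriv.1
    obtain ⟨c, hc1, hc2, hcx⟩ := exists_cell (rHi r - rLo r) (rLo r) (rHi r) (by omega) hl1 hxlo hxhi
    have hokc : ok c = true := okc (by omega) (by omega) (fun h => hx0 h ▸ hcx) (fun h h' => hx1 h h' ▸ hcx)
      (fun h h' => hx2 h h' ▸ hcx)
    obtain ⟨lo', e1, hlo1, hlo2, -⟩ := firstOk_spec ok (rHi r + 1 - rLo r) (rLo r) c hc1 (by omega) hokc
    rw [← hok, e1]
    simp only
    obtain ⟨hi', e2, hhi1, hhi2, -⟩ := lastOk_spec ok (rHi r + 1 - lo') (rHi r) c hc2 (by omega) hokc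
    rw [e2]
    simp only
    -- the new code is truthful
    have vnew : ValidDom (mkR lo' hi') := validDom_mkR (by omega) (by omega) (by omega)
    have elo : rLo (mkR lo' hi') = lo' := by unfold rLo mkR; have : K = 15 := rfl; omega
    have ehi : rHi (mkR lo' hi') = hi' := by unfold rHi mkR; have : K = 15 := rfl; omega
    have hne0 : mkR lo' hi' ≠ 0 := by unfold mkR; omega
    have hneU : mkR lo' hi' ≠ UNL := by unfold mkR UNL; have : K = 15 := rfl; omega
    have hcell := (symMem_cell_iff (by omega : c ≠ 0)).1 hcx
    have semx : DomSem (mkR lo' hi') x := by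
      right; right
      refine ⟨vnew, hne0, hxne, ?_, ?_⟩
      · rw [elo]
        exact le_trans (by exact_mod_cast gridPt_mono (by omega : lo' - 1 ≤ c - 1)) hcell.1
      · rw [ehi]
        exact le_trans hcell.2 (by exact_mod_cast gridPt_mono hhi1)
    refine ⟨by split_ifs <;> exact Option.some_ne_none _, fun s' hs' => ?_⟩
    split_ifs at hs' with hsame r0 r1
    · cases hs'; exact ⟨hR, rfl, rfl⟩
    · cases hs'; rw [hx0 r0] at semx; exact ⟨hR.sdom hv12 ha12 hva lva hneU semx, rfl, rfl⟩
    · cases hs'; rw [hx1 r0 r1] at semx; exact ⟨hR.sdom hv12 hb12 hvb lvb hneU semx, rfl, rfl⟩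
    · cases hs'; rw [hx2 r0 r1] at semx; exact ⟨hR.sdom ha12 hb12 hab lab hneU semx, rfl, rfl⟩

/-- Membership in `trisAt`. [folklore] -/
theorem mem_trisAt {s : St} {v t : ℕ} : t ∈ s.trisAt v ↔ t ∈ s.tris.toList ∧ tmem t v = true := by
  unfold St.trisAt
  rw [← Array.foldr_toList]
  induction s.tris.toList with
  | nil => simp
  | cons x L ih =>
    rw [List.foldr_cons]
    by_cases hx : tmem x v = true
    · rw [if_pos hx, List.mem_cons, ih, List.mem_cons]
      constructor
      · rintro (rfl | ⟨h1, h2⟩)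
        · exact ⟨Or.inl rfl, hx⟩
        · exact ⟨Or.inr h1, h2⟩
      · rintro ⟨rfl | h1, h2⟩
        · exact Or.inl rfl
        · exact Or.inr ⟨h1, h2⟩
    · rw [if_neg hx, ih, List.mem_cons]
      constructor
      · rintro ⟨h1, h2⟩; exact ⟨Or.inr h1, h2⟩
      · rintro ⟨rfl | h1, h2⟩
        · exact absurd h2 hx
        · exact ⟨h1, h2⟩

/-- A fold of `Option`-valued steps that never kill realized states and keep them realized (and
keep the triangles) ends realized. [folklore] -/
theorem fold_opt_sound {M : KConf} (L : List ℕ) (f : St → ℕ → Option St)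
    (hf : ∀ s x, x ∈ L → Realizes M s → (f s x ≠ none ∧ ∀ s', f s x = some s' → Realizes M s' ∧ s'.tris = s.tris)) :
    ∀ (s : St), Realizes M s →
      (L.foldl (fun os x => match os with | none => none | some s => f s x) (some s)) ≠ none ∧
      ∀ s', L.foldl (fun os x => match os with | none => none | some s => f s x) (some s) = some s' →
        Realizes M s' ∧ s'.tris = s.tris := by
  induction L with
  | nil => intro s hs; simp [hs]
  | cons x L ih =>
    intro s hs
    rw [List.foldl_cons]
    obtain ⟨h1, h2⟩ := hf s x (by simp) hs
    obtain ⟨s1, e1⟩ := Option.ne_none_iff_exists'.1 h1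
    obtain ⟨hs1, ht1⟩ := h2 s1 e1
    simp only [e1]
    obtain ⟨i1, i2⟩ := ih (fun s' y hy hs' => hf s' y (by simp [hy]) hs') s1 hs1
    exact ⟨i1, fun s' hs' => let ⟨q1, q2⟩ := i2 s' hs'; ⟨q1, q2.trans ht1⟩⟩

/-- A killed fold stays killed. [folklore] -/
theorem foldl_none {f : St → ℕ → Option St} (L : List ℕ) :
    L.foldl (fun os x => match os with | none => none | some s => f s x) none = none := by
  induction L with
  | nil => rfl
  | cons x L ih => rw [List.foldl_cons]; exact ih

/-- **Soundness of `trimTrisAt`** (feasibility trims, window `[0, NLAD δ] ⊇ [0, π]`). [folklore] -/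
theorem trimTrisAt_sound {M : KConf} {s : St} (hR : Realizes M s) (v : ℕ) :
    s.trimTrisAt v ≠ none ∧ ∀ s', s.trimTrisAt v = some s' → Realizes M s' ∧ s'.tris = s.tris := by
  unfold St.trimTrisAt
  -- one triangle: three trims at its vertex `tv0`
  have step : ∀ (s1 : St) (t : ℕ), t ∈ s.trisAt v → Realizes M s1 → s1.tris = s.tris →
      ((match s1.trimSide t (tv0 t) 0 0 NLAD with
        | none => none
        | some s2 => match s2.trimSide t (tv0 t) 1 0 NLAD with
          | none => none
          | some s3 => s3.trimSide t (tv0 t) 2 0 NLAD) ≠ none) ∧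
      ∀ s', (match s1.trimSide t (tv0 t) 0 0 NLAD with
        | none => none
        | some s2 => match s2.trimSide t (tv0 t) 1 0 NLAD with
          | none => none
          | some s3 => s3.trimSide t (tv0 t) 2 0 NLAD) = some s' → Realizes M s' ∧ s'.tris = s1.tris := by
    intro s1 t ht hs1 htr
    have ht1 : t ∈ s1.tris.toList := by rw [htr]; exact (mem_trisAt.1 ht).1
    have hv0 : tv0 t ∈ tset t := by unfold tset; simp
    have hw : ∀ s2 : St, ((0 : ℕ) : ℝ) * (δ : ℝ) ≤ M.ang (tset t) (tv0 t) ∧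
        M.ang (tset t) (tv0 t) ≤ ((NLAD : ℕ) : ℝ) * (δ : ℝ) := fun _ =>
      ⟨by simpa using M.ang_nonneg _ _, (M.ang_le_pi _ _).trans pi_lt_NLAD_mul.le⟩
    obtain ⟨n1, k1⟩ := trimSide_sound hs1 ht1 hv0 0 0 NLAD (hw s1)
    obtain ⟨s2, e2⟩ := Option.ne_none_iff_exists'.1 n1
    obtain ⟨hs2, t2, -⟩ := k1 s2 e2
    simp only [e2]
    obtain ⟨n2, k2⟩ := trimSide_sound hs2 (by rw [t2]; exact ht1) hv0 1 0 NLAD (hw s2)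
    obtain ⟨s3, e3⟩ := Option.ne_none_iff_exists'.1 n2
    obtain ⟨hs3, t3, -⟩ := k2 s3 e3
    simp only [e3]
    obtain ⟨n3, k3⟩ := trimSide_sound hs3 (by rw [t3, t2]; exact ht1) hv0 2 0 NLAD (hw s3)
    exact ⟨n3, fun s' e4 => ⟨(k3 s' e4).1, by rw [(k3 s' e4).2.1, t3, t2]⟩⟩
  -- fold
  have gen : ∀ (L : List ℕ), (∀ t ∈ L, t ∈ s.trisAt v) → ∀ (s1 : St), Realizes M s1 → s1.tris = s.tris →
      (L.foldl (fun os t => match os with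
        | none => none
        | some s => match s.trimSide t (tv0 t) 0 0 NLAD with
          | none => none
          | some s => match s.trimSide t (tv0 t) 1 0 NLAD with
            | none => none
            | some s => s.trimSide t (tv0 t) 2 0 NLAD) (some s1)) ≠ none ∧
      ∀ s', (L.foldl (fun os t => match os with
        | none => none
        | some s => match s.trimSide t (tv0 t) 0 0 NLAD with
          | none => none
          | some s => match s.trimSide t (tv0 t) 1 0 NLAD with
            | none => none
            | some s => s.trimSide t (tv0 t) 2 0 NLAD) (some s1)) = some s' → Realizes M s' ∧ s'.tris = s.tris := by
    intro L
    induction L with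
    | nil => intro _ s1 hs1 htr; simp [hs1, htr]
    | cons t L ih =>
      intro hL s1 hs1 htr
      rw [List.foldl_cons]
      obtain ⟨n1, k1⟩ := step s1 t (hL t (by simp)) hs1 htr
      obtain ⟨s2, e2⟩ := Option.ne_none_iff_exists'.1 n1
      obtain ⟨hs2, ht2⟩ := k1 s2 e2
      simp only [e2]
      exact ih (fun t' ht' => hL t' (by simp [ht'])) s2 hs2 (ht2.trans htr)
  exact gen _ (fun t ht => ht) s hR rfl

/-! ### Part C. The pairing rule -/

/-- `ZCELL = 11`. [folklore] -/
theorem ZCELL_eq : ZCELL = 11 := rfl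

/-- The cells below `ZCELL` are entirely negative: `gridPt j < 0` for `j < 11`. [folklore] -/
theorem gridPt_neg {j : ℕ} (hj : j < 11) : gridPt j < 0 := by
  have h10 : gridPt 10 < 0 := by unfold gridPt κ0 K; norm_num
  exact lt_of_le_of_lt (gridPt_mono (by omega)) h10

/-- The third vertex of a valid code containing `a ≠ b`. [folklore] -/
theorem third_vertex {t a b : ℕ} (ht : TriValid t) (ha : a ∈ tset t) (hb : b ∈ tset t) (hab : a ≠ b) :
    tv0 t + tv1 t + tv2 t - a - b ∈ tset t ∧ tv0 t + tv1 t + tv2 t - a - b ≠ a ∧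
      tv0 t + tv1 t + tv2 t - a - b ≠ b ∧ tset t = {a, b, tv0 t + tv1 t + tv2 t - a - b} := by
  obtain ⟨h1, h2, h3, -⟩ := ht
  unfold tset at ha hb ⊢
  simp only [Finset.mem_insert, Finset.mem_singleton] at ha hb ⊢
  refine ⟨by omega, by omega, by omega, ?_⟩
  ext x
  simp only [Finset.mem_insert, Finset.mem_singleton]
  omega

/-- **Meaning of `apexes`**: the third vertices of the placed triangles through `{a, b}`, namely
the map of that filter of the placed list (in reverse order). [folklore] -/
theorem apexes_eq (s : St) (a b : ℕ) :
    s.apexes a b = ((s.tris.toList.filter fun t => tmem t a && tmem t b).map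
      fun t => tv0 t + tv1 t + tv2 t - a - b).reverse := by
  unfold St.apexes
  rw [← Array.foldl_toList]
  suffices h : ∀ (L : List ℕ) (acc : List ℕ),
      L.foldl (fun l t => if (tmem t a && tmem t b) = true then (tv0 t + tv1 t + tv2 t - a - b) :: l else l) acc =
        ((L.filter fun t => tmem t a && tmem t b).map fun t => tv0 t + tv1 t + tv2 t - a - b).reverse ++ acc by
    simpa using h s.tris.toList []
  intro L
  induction L with
  | nil => intro acc; simp
  | cons t L ih =>
    intro acc
    rw [List.foldl_cons, List.filter_cons]
    by_cases h : (tmem t a && tmem t b) = true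
    · rw [if_pos h, ih]
      simp [h]
    · rw [if_neg h, ih]
      simp [h]

/-- In a realized state, two placed triangles on a labelled-contact configuration around a long
side force its cosine to be nonnegative. **Soundness of `pairRuleAt`.**
[cite: Hales2012, proof of Theorem 2] -/
theorem pairRuleAt_sound {M : KConf} {s : St} (hR : Realizes M s) {a b : ℕ} (ha : a < 12) (hb : b < 12)
    (hab : a ≠ b) :
    s.pairRuleAt a b ≠ none ∧ ∀ s', s.pairRuleAt a b = some s' → Realizes M s' ∧ s'.tris = s.tris := by
  unfold St.pairRuleAt
  simp only
  by_cases htriv : s.gdom a b = 0 ∨ s.gdom a b = UNL ∨ s.gsc a b ≠ 2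
  · rw [if_pos htriv]; exact ⟨by simp, fun s' h => by cases h; exact ⟨hR, rfl⟩⟩
  · rw [if_neg htriv]
    simp only [not_or, not_not] at htriv
    obtain ⟨hr0, hrU, hsc2⟩ := htriv
    by_cases hcond : (s.apexes a b).length = 2 ∧ (s.apexes a b).all (fun w => s.gdom w a == 0 && s.gdom w b == 0) = true
    · rw [if_pos hcond]
      -- the geometry: `0 ≤ g a b`
      have hsem := hR.dom a b ha hb hab
      rcases hsem with h | ⟨h, -⟩ | ⟨vd, -, hxne, hxlo, hxhi⟩
      · exact absurd h hrU
      · exact absurd h hr0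
      rcases vd with h | ⟨hl1, hl2, hl3, hl4⟩
      · exact absurd h hr0
      -- the two placed triangles through `{a, b}`
      set F := s.tris.toList.filter (fun t => tmem t a && tmem t b) with hF
      have hlen : F.length = 2 := by rw [hF, ← hR.sc_eq a b ha hb hab]; exact hsc2
      obtain ⟨t1, t2, hF12⟩ : ∃ t1 t2, F = [t1, t2] := by
        match F, hlen with
        | [t1, t2], _ => exact ⟨t1, t2, rfl⟩
      have ht1F : t1 ∈ F := by rw [hF12]; simp
      have ht2F : t2 ∈ F := by rw [hF12]; simp
      have hnd : F.Nodup := hR.nodup.filter _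
      have ht12 : t1 ≠ t2 := by
        rw [hF12] at hnd
        simp only [List.nodup_cons, List.mem_singleton, List.not_mem_nil, not_false_eq_true,
          List.nodup_nil, and_true] at hnd
        exact hnd
      rw [hF, List.mem_filter] at ht1F ht2F
      obtain ⟨ht1, hm1⟩ := ht1F
      obtain ⟨ht2, hm2⟩ := ht2F
      simp only [Bool.and_eq_true] at hm1 hm2
      have v1 := hR.valid t1 ht1
      have v2 := hR.valid t2 ht2
      have a1 : a ∈ tset t1 := tmem_iff.1 hm1.1
      have b1 : b ∈ tset t1 := tmem_iff.1 hm1.2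
      have a2 : a ∈ tset t2 := tmem_iff.1 hm2.1
      have b2 : b ∈ tset t2 := tmem_iff.1 hm2.2
      obtain ⟨w1m, w1a, w1b, hset1⟩ := third_vertex v1 a1 b1 hab
      obtain ⟨w2m, w2a, w2b, hset2⟩ := third_vertex v2 a2 b2 hab
      set w1 := tv0 t1 + tv1 t1 + tv2 t1 - a - b with hw1
      set w2 := tv0 t2 + tv1 t2 + tv2 t2 - a - b with hw2
      have hw12 : w1 ≠ w2 := by
        intro e
        apply ht12
        exact eq_of_tset_eq v1 v2 (by rw [hset1, hset2, e])
      -- the four contacts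
      have hap : s.apexes a b = [w2, w1] := by
        rw [apexes_eq, ← hF, hF12]; simp [hw1, hw2]
      obtain ⟨-, hall⟩ := hcond
      rw [hap] at hall
      simp only [List.all_cons, List.all_nil, Bool.and_true, Bool.and_eq_true, beq_iff_eq] at hall
      obtain ⟨⟨h2a, h2b⟩, ⟨h1a, h1b⟩⟩ := hall
      have w1_12 : w1 < 12 := lt_of_mem_tset v1 w1m
      have w2_12 : w2 < 12 := lt_of_mem_tset v2 w2m
      have contact : ∀ {w x : ℕ}, w < 12 → x < 12 → w ≠ x → s.gdom w x = 0 → M.g w x = 1 / 2 := by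
        intro w x hw hx hwx h0
        rcases hR.dom w x hw hx hwx with h | ⟨-, h⟩ | ⟨-, h, -⟩
        · rw [h0] at h; exact absurd h (by unfold UNL; norm_num)
        · exact h
        · exact absurd h0 h
      have g1a := contact w1_12 ha w1a h1a
      have g1b := contact w1_12 hb w1b h1b
      have g2a := contact w2_12 ha w2a h2a
      have g2b := contact w2_12 hb w2b h2b
      have T1 : ({a, b, w1} : Finset ℕ) ∈ M.T := by rw [← hset1]; exact hR.mem t1 ht1
      have T2 : ({a, b, w2} : Finset ℕ) ∈ M.T := by rw [← hset2]; exact hR.mem t2 ht2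
      have hnn : 0 ≤ M.g a b := M.pairing a b w1 w2 hab hw12 T1 T2 g1a g1b g2a g2b
      -- the cells
      rw [ZCELL_eq]
      by_cases hkill : rHi (s.gdom a b) < max (rLo (s.gdom a b)) 11
      · rw [if_pos hkill]
        exfalso
        have hlt : rHi (s.gdom a b) < 11 := by omega
        have := gridPt_neg hlt
        have : ((gridPt (rHi (s.gdom a b)) : ℚ) : ℝ) < 0 := by exact_mod_cast this
        linarith
      · rw [if_neg hkill]
        by_cases hsame : max (rLo (s.gdom a b)) 11 = rLo (s.gdom a b)
        · rw [if_pos hsame]; exact ⟨by simp, fun s' h => by cases h; exact ⟨hR, rfl⟩⟩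
        · rw [if_neg hsame]
          refine ⟨by simp, fun s' h => ?_⟩
          cases h
          refine ⟨hR.sdom ha hb hab hrU ?_ ?_, rfl⟩
          · unfold mkR UNL; have : K = 15 := rfl; omega
          · have hmax : max (rLo (s.gdom a b)) 11 = 11 := by omega
            rw [hmax]
            have hhi : 11 ≤ rHi (s.gdom a b) := by omega
            have vnew : ValidDom (mkR 11 (rHi (s.gdom a b))) := validDom_mkR (by norm_num) hhi hl3
            have elo : rLo (mkR 11 (rHi (s.gdom a b))) = 11 := by unfold rLo mkR; have : K = 15 := rfl; omega
            have ehi : rHi (mkR 11 (rHi (s.gdom a b))) = rHi (s.gdom a b) := by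
              unfold rHi mkR; have : K = 15 := rfl; omega
            right; right
            refine ⟨vnew, by unfold mkR; omega, hxne, ?_, ?_⟩
            · rw [elo]
              have := gridPt_neg (by norm_num : 10 < 11)
              have : ((gridPt 10 : ℚ) : ℝ) < 0 := by exact_mod_cast this
              exact le_trans this.le hnn
            · rw [ehi]; exact hxhi
    · rw [if_neg hcond]; exact ⟨by simp, fun s' h => by cases h; exact ⟨hR, rfl⟩⟩

/-- **Soundness of `pairRulesAt`.** [folklore] -/
theorem pairRulesAt_sound {M : KConf} {s : St} (hR : Realizes M s) {v : ℕ} (hv : v < 12) :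
    s.pairRulesAt v ≠ none ∧ ∀ s', s.pairRulesAt v = some s' → Realizes M s' ∧ s'.tris = s.tris := by
  unfold St.pairRulesAt
  rw [foldRange_eq_foldl]
  have hf : ∀ (s1 : St) (u : ℕ), u ∈ List.range' 0 12 → Realizes M s1 →
      ((if u = v then some s1 else s1.pairRuleAt u v) ≠ none ∧
        ∀ s', (if u = v then some s1 else s1.pairRuleAt u v) = some s' → Realizes M s' ∧ s'.tris = s1.tris) := by
    intro s1 u hu hs1
    rw [List.mem_range'_1] at hu
    by_cases huv : u = v
    · rw [if_pos huv]; exact ⟨by simp, fun s' h => by cases h; exact ⟨hs1, rfl⟩⟩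
    · rw [if_neg huv]; exact pairRuleAt_sound hs1 (by omega) hv huv
  exact fold_opt_sound (M := M) (List.range' 0 12) (fun s1 u => if u = v then some s1 else s1.pairRuleAt u v) hf s hR

end KissingSearch

end Literature.Geometry.DiscreteGeometry
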